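import Summits.BirchSwinnertonDyer.Rank1Residual.Additive.CongruentPartnerMainConjectureGord
import Summits.BirchSwinnertonDyer.Rank1Residual.Additive.CongruentLambdaShiftOfEPW
import Literature.NumberTheory.EllipticCurves.NonEisensteinPrimeOfSurjective
import HarnessLib

/-!
# "X4 ROUTE G", FILE 4: the congruent-partner inputs of K-C′ DISCHARGED from the cited EPW 2006
# algebraic transfer (cc-typer-1's `CongruentLambdaShiftOfEPW.lean`) — and `μ(X(E/ℚ_∞)) = 0` on a
# certified X4♯(G-ord) row from Kato half + ONE unit coefficient alone
# (team n1011, seat p10 gen 2, OWNERS row T-E3d FILE 4; lead GEN 6 R5-27 "p10's F4 `…_of_epw`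
# wrappers follow F2/F3"; cc-typer-1 GEN 4 p255019 / p255240)

HONEST FRAMING (cell `b2b-bsdres`, run/shared/lean/b2b/bsd-rank1-residual/, verbatim in every
file): the goal of the cell is to DELETE the COMBINATION-SHAPED residual classes of the
Birch–Swinnerton-Dyer formula for ALL analytic-rank `≤ 1` elliptic curves over `ℚ` — "full BSD
formula for every rank `≤ 1` curve in class `C`" assembled STRICTLY from published theorems — so
that the rank-`≤ 1` remainder becomes exactly the CONSTRUCTION-SHAPED classes, which are TYPED
(missing-input `Prop`s), NOT attempted. This is not "finishing BSD". Team n1011 (N10/N11: X4 ∧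
`p = 3`): research route on the CONSTRUCTION-SHAPED class X4; prove what is provable now; no claim
beyond stated classes; census output = EVIDENCE / conjecture items, never a Literature fact;
X4♯(G-ord) stays CONSTRUCTION-SHAPED; RESIDUAL-MAP marks UNCHANGED; nothing is booked by this file.
Theorems only: NO definition, NO new named fact, NO conjecture node. The named facts enter as
HYPOTHESES: `hK` (the semistable half-eigenspace reading of Kato 2004 Thm. 17.4 (3)) and `hEPW`
(`EmertonPollackWeston2006.muLambdaAlg_transfer_of_torsionIso_potOrd`, EPW 2006 Thm. 3.3.2 /
Thm. 3.3.3 (2) / Lemma 5.1.5, cc-typer-1's ONE cited fact of ruling R5-20).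

## What and why (ROUTE-2 II.10 K-C′; skeleton `cells/n1011/skel/T-E3d.md` FILE 4)

FILE 2 (`CongruentPartnerMainConjectureGord.lean`) proves the branch main conjecture at a certified
X4♯(G-ord) ∩ `I₀*` ∩ {`ρ̄_{E,p}` onto} row `E` from a CONGRUENT PARTNER `E₁` under three typed per-pair
inputs: `TorsionIso W W₁ p`, the λ-shift schema `CongruentLambdaShift W W₁ p e` and `μ(X(E₁)) = 0`
(`ClassX4Gord.mainConjecture_of_katoHalf_of_coeffCert_of_congruentPartner`). cc-typer-1's
`congruentLambdaShift_of_epw` / `mu_eq_zero_of_epw` derive the first two, and transfer `μ = 0` from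
`E` to `E₁`, from the cited EPW fact `hEPW` given: `p ≠ 2` (automatic on X4), the place `v ∋ p`,
RAMIFIED ORDINARY LINES `L`, `L₁` at `v` for both curves (`IsRamifiedOrdinaryLine`), `E[p]`
irreducible (here: from `ρ̄_{E,p}` onto, `hasIrreducibleModPGaloisRep_of_hasSurjectiveModNGaloisRep`),
a `Γ_ℚ`-equivariant `E[p] ≃ E₁[p]` carrying `C[p]` to `C₁[p]`, and a finite set `Σ₀ ∌ p` of places
outside which both curves are good; the shift is then EXPLICIT, `e = Σ_{w ∈ Σ₀} (δ(E₁,w) − δ(E,w))`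
(`δ = GreenbergVatsal2000.delta`). This file composes:
* §1 `ClassX4Gord.isTorsion_and_mu_zero_of_katoHalf_of_coeff[Cert]` — on the rows of FILE 2, Kato
  half + ONE unit coefficient of the Néron-normalised branch (ANY index) already give `X(E/ℚ_∞)`
  torsion AND `μ(X(E/ℚ_∞)) = 0` (no lower bound needed: `char = (fE)`, `fE ∣ g`, `g` of unit content
  ⟹ `fE` of unit content) — the SOURCE of EPW's `μ`-transfer to the partner;
* §2 `ClassX4Gord.mainConjecture_of_katoHalf_of_coeffCert_of_epw` — K-C′ with the EPW data in
  place of `TorsionIso` / `CongruentLambdaShift` / `μ(X(E₁)) = 0`: the residual per-pair inputs are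
  exactly the two ramified-ordinary-line data, the line-respecting `E[p] ≅ E₁[p]`, `Σ₀`, ONE unit
  coefficient at `E` at index `b = r₁ + e`, and a lower bound `r₁ ≤ λ(X(E₁))`; conclusion: MC on the
  branch at `E` with `μ = 0`, `λ(X(E)) = b`, and at the partner `μ(X(E₁)) = 0`, `λ(X(E₁)) = r₁`;
  `…_of_epw_of_partnerZero` is the case `r₁ = 0` (no input at the partner at all beyond the lines).
Binder honesty: `hK`, `hEPW` named facts (hypotheses); `ClassX4Gord W p`, `e_E(p) = 2`, `Surj W p`
class binders; the EPW data (lines, line-respecting isomorphism, `Σ₀`), the unit coefficient (ENGINE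
value, two-engine rule) and `r₁ ≤ λ(X(E₁))` are per-pair EVIDENCE / instrument tier until certified;
READING OF RECORD (referee 1 ACK-1 proviso P1): per additive pair EPW 2006 Thm. 3.3.3 is applied in
its `ω^i`-form (LIT-INPUTS-P3 §11.1, arXiv math/0404484 p0019 L147–166) on the HIDA FAMILY of `ρ̄_{E♭}`
(the `p`-ordinary twist model) at `i = (p−1)/2`, NEVER on `f_E` itself (`a_p(E) = 0`) — which is what
`IsRamifiedOrdinaryLine` encodes on the algebraic side; `e = B(E,p) − B(E₁,p)`, `b = B(E,p)` (P2);
nothing booked; no class theorem closes a row by itself.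

References: Emerton–Pollack–Weston, Invent. Math. 163 (2006) Thms. 3.3.2, 3.3.3, Lemma 5.1.5
(arXiv math/0404484 pp. 19, 30) [EmertonPollackWeston2006]; Kato, Astérisque 295 (2004) Thm. 17.4 (3)
[Kato2004Asterisque]; Greenberg–Vatsal, Invent. Math. 142 (2000) §2 [GreenbergVatsal2000];
Serre, Invent. Math. 15 (1972) §4 (onto ⟹ irreducible) [Serre1972]; Washington GTM 83 §13.2
[Washington1997].
-/

set_option autoImplicit false

noncomputable section

open scoped Classical MatrixGroups ModularForm NumberField

open CongruenceSubgroup WeierstrassCurve NumberField Field Literature.NumberTheory.EllipticCurves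
  Literature.NumberTheory.EllipticCurves.ModularForms
  Literature.NumberTheory.EllipticCurves.Rank1Residual
  Literature.NumberTheory.EllipticCurves.Rank1Residual.Typed
  Literature.NumberTheory.GaloisRepresentations
  Literature.NumberTheory.EllipticCurves.GreenbergSelmer
  Literature.NumberTheory.EllipticCurves.Wuthrich2014
  Literature.NumberTheory.EllipticCurves.GreenbergVatsal2000
  Literature.NumberTheory.EllipticCurves.EmertonPollackWeston2006
  Summit.BirchSwinnertonDyer.Rank1Residual.AdditivePotMult
  Summit.BirchSwinnertonDyer.Rank1Residual.X1.MuLambda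
  Summit.BirchSwinnertonDyer.Rank1Residual.X11a
  Summit.BirchSwinnertonDyer.Rank1Residual.Iwasawa
  IsDedekindDomain

open Summit.BirchSwinnertonDyer.Rank1Residual.X1.CongruenceTransfer (TorsionIso CongruentLambdaShift)

namespace Summit.BirchSwinnertonDyer.Rank1Residual.Additive

variable {W : WeierstrassCurve ℚ} [W.IsElliptic] [W.IsGloballyMinimal] {p : ℕ} [hp : Fact p.Prime]

/-! ### §1 `X(E/ℚ_∞)` torsion and `μ = 0` from Kato half + ONE unit coefficient (any index) -/

omit [W.IsGloballyMinimal] in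
/-- **`X` torsion and `μ(X(E/ℚ_∞)) = 0`, per datum.** For `W` in X4♯(G-ord) with the full `p`-adic
tower of `E` onto, a globally minimal good-ordinary `V` with `C • V^{(p*)} = W`, the cyclotomic data,
a newform `f` of `V`, a period ratio `ϖ` of the parity of `(p−1)/2` and a finitely generated dual
datum `D`: ONE `p`-adic unit coefficient of the Néron-normalised branch `ϖ·B_{(p−1)/2}(f, α)` at ANY
index `n` gives `X` torsion and `μ(X) = 0` — Kato half puts an integral `g` with `ι g = C(u·ϖ)·B` in
`char X = (fE)`, the unit coefficient gives `g` unit content, hence `fE ∣ g` has unit content. No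
lower bound on `λ` is needed. [cite: Kato2004Asterisque, Thm. 17.4 (3) (p. 273)]
[cite: Washington1997, §13.2] -/
theorem ClassX4Gord.isTorsion_and_mu_zero_of_katoHalf_of_coeff
    (hK : Wuthrich2014.kato_halfEigenCharIdeal_dvd_cyclotomicPrime_of_surjective)
    (hX : ClassX4Gord W p) (htower : ∀ n : ℕ, W.HasSurjectiveModNGaloisRep (p ^ n : ℕ))
    (V : WeierstrassCurve ℚ) [V.IsElliptic] [V.IsGloballyMinimal]
    (hCW : ∃ C : VariableChange ℚ, C • V.quadraticTwist ((-1 : ℚ) ^ (p / 2) * p) = W)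
    (hV : GoodOrd V p)
    {κ : ZpExtension ℚ p} {γ : Field.absoluteGaloisGroup ℚ} {N : ℕ} [NeZero N]
    {f : CuspForm (Gamma0 N) 2}
    (hκ : κ.IsCyclotomic) (hγ : κ.IsTopGenerator γ) (hcv : IsCyclotomicVariable p γ)
    (hf : IsNewformOf V f) (D : W.SelmerDualData κ γ) [Module.Finite (IwasawaAlgebra p) D.X] (ϖ : ℚ)
    (hϖ : if Even (p / 2) then (ϖ : ℝ) * V.realPeriodRat = plusPeriod f
      else (ϖ : ℝ) * V.imaginaryPeriodRat = minusPeriod f)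
    {n : ℕ}
    (hcoeff : ‖PowerSeries.coeff n (PowerSeries.C (ϖ : ℚ_[p]) *
        (if Even (p / 2) then padicLFunctionBranch f ((unitRoot V p : ℤ_[p]) : ℚ_[p]) (p / 2)
          else padicLFunctionMinusBranch f ((unitRoot V p : ℤ_[p]) : ℚ_[p]) (p / 2)))‖ = 1) :
    D.IsTorsion ∧ D.mu = 0 := by
  have hp2 : p ≠ 2 := hX.addv.1
  have hpne : ((-1 : ℚ) ^ (p / 2) * p) ≠ 0 := pStar_ne_zero p
  have hj := padicValRat_j_nonneg_of_typeGOrd W p hX.typeGOrd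
  have htowerV : ∀ n : ℕ, V.HasSurjectiveModNGaloisRep (p ^ n : ℕ) := fun n ↦
    (GaloisImage.hasSurjectiveModNGaloisRep_pow_iff_of_model_twist V p hpne hCW n).mp (htower n)
  obtain ⟨hXt, g, hg, u, hι⟩ := isTorsion_and_exists_iota_eq_branch_of_katoComponent W p
    (Kato2004.charIdeal_dvd_padicLFunctionBranch_component_of_surjective_of_half hK) hj hp2 V hCW
    (Or.inl hV) htowerV hκ hγ hcv hf D ϖ hϖ
  obtain ⟨hgc, -⟩ := hasUnitContent_and_lam_le_of_iota_eq_of_norm_coeff_eq_one hι hcoeff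
  obtain ⟨fE, hchar⟩ := exists_charIdeal_eq_span D hXt
  have hdvd : fE ∣ g := by
    rw [hchar] at hg
    exact Ideal.mem_span_singleton.mp hg
  exact ⟨hXt, mu_zero_of_charIdeal_eq_span_of_dvd D hXt hchar hgc hdvd⟩

/-- **`X` torsion and `μ(X(E/ℚ_∞)) = 0` on a certified row (class form).** X4♯(G-ord) ∩ `I₀*` ∩
{`ρ̄_{E,p}` onto}, every odd `p` (tower from surj by `ClassX4Gord.towerSurj_of_surj`): Kato half +
`BranchUnitCoeffAt W p b` (ANY `b`) ⟹ for the cyclotomic data and every good-ordinary twist model /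
newform / period ratio / dual datum: `X` torsion and `μ(X) = 0`. The source of the `μ`-transfer of §2.
[cite: Kato2004Asterisque, Thm. 17.4 (3) (p. 273)] [cite: Washington1997, §13.2] -/
theorem ClassX4Gord.isTorsion_and_mu_zero_of_katoHalf_of_coeffCert
    (hK : Wuthrich2014.kato_halfEigenCharIdeal_dvd_cyclotomicPrime_of_surjective)
    (hX : ClassX4Gord W p) (he : semistabilityIndex W p = 2) (hsurj : Surj W p)
    {b : ℕ} (hcert : BranchUnitCoeffAt W p b)
    (V : WeierstrassCurve ℚ) [V.IsElliptic] [V.IsGloballyMinimal] (C : VariableChange ℚ)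
    (hC : C • V.quadraticTwist ((-1 : ℚ) ^ (p / 2) * p) = W) (hV : GoodOrd V p)
    {κ : ZpExtension ℚ p} {γ : Field.absoluteGaloisGroup ℚ} {N : ℕ} [NeZero N]
    {f : CuspForm (Gamma0 N) 2}
    (hκ : κ.IsCyclotomic) (hγ : κ.IsTopGenerator γ) (hcv : IsCyclotomicVariable p γ)
    (hf : IsNewformOf V f) (D : W.SelmerDualData κ γ) (ϖ : ℚ)
    (hϖ : if Even (p / 2) then (ϖ : ℝ) * V.realPeriodRat = plusPeriod f
      else (ϖ : ℝ) * V.imaginaryPeriodRat = minusPeriod f) :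
    D.IsTorsion ∧ D.mu = 0 := by
  haveI : Module.Finite (IwasawaAlgebra p) D.X :=
    SelmerDualData.module_finite_of_isCyclotomic (W := W) (κ := κ) hκ D hγ
  have hord : IsOrdinaryAt V p := isOrdinaryAt_of_goodOrd_or_mult_of_model_twist W V (pStar_ne_zero p)
    ⟨C, hC⟩ (padicValRat_j_nonneg_of_typeGOrd W p hX.typeGOrd) (Or.inl hV)
  exact hX.isTorsion_and_mu_zero_of_katoHalf_of_coeff hK (hX.towerSurj_of_surj he hsurj) V ⟨C, hC⟩ hV
    hκ hγ hcv hf D ϖ hϖ (hcert V C hC hord f hf ϖ hϖ)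

/-! ### §2 K-C′ with the congruent-partner inputs DISCHARGED from the EPW transfer -/

/-- **K-C′ from the EPW data (class form).** X4♯(G-ord) ∩ `I₀*` ∩ {`ρ̄_{E,p}` onto}, every odd `p`;
a globally minimal partner `W₁`; the cited EPW fact `hEPW`; the place `v ∋ p`; ramified ordinary lines
`L`, `L₁` at `v` for `W`, `W₁` (`IsRamifiedOrdinaryLine` — additive potentially-ordinary reduction, the
Hida-family reading of referee 1's proviso P1); a `Γ_ℚ`-equivariant `E[p] ≃ E₁[p]` carrying `C[p]` to
`C₁[p]`; a finite set of places `Σ₀ ∌ p` outside which both curves are good; at the partner a torsion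
dual datum with `r₁ ≤ λ(X(E₁))`; at `E` ONE unit coefficient at index `b = r₁ + e`,
`e = Σ_{w ∈ Σ₀} (δ(E₁,w) − δ(E,w))`. THEN: the branch main conjecture at `E` (`char_Λ X = (g)`,
`ι g = C(u·ϖ)·B`, `μ(X(E)) = 0`, `λ(X(E)) = b`), and at the partner `μ(X(E₁)) = 0` (transferred FROM
`E`, §1 + EPW Thm. 3.3.2) and `λ(X(E₁)) = r₁`. `E[p]` irreducible is supplied by `ρ̄_{E,p}` onto.
READING OF RECORD (referee 1 ACK-1 proviso P1, 2026-08-21): per additive pair EPW 2006 Thm. 3.3.3 is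
applied in its `ω^i`-form (LIT-INPUTS-P3 §11.1, arXiv math/0404484 p0019 L147–166) on the HIDA FAMILY
of `ρ̄_{E♭}` — the `p`-ordinary twist model — at `i = (p−1)/2`, NEVER on `f_E` itself (`a_p(E) = 0`);
`e = B(E,p) − B(E₁,p)`, `b = B(E,p)` the `p`-Tamagawa budget (P2).
[cite: EmertonPollackWeston2006, Thm. 3.3.2, Thm. 3.3.3 (2) (arXiv:math/0404484 p. 19), Lemma 5.1.5 (p. 30)]
[cite: Kato2004Asterisque, Thm. 17.4 (3) (p. 273)] [cite: GreenbergVatsal2000, §2 Prop. (2.4) (δ)] -/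
theorem ClassX4Gord.mainConjecture_of_katoHalf_of_coeffCert_of_epw
    (hK : Wuthrich2014.kato_halfEigenCharIdeal_dvd_cyclotomicPrime_of_surjective)
    (hEPW : muLambdaAlg_transfer_of_torsionIso_potOrd)
    (hX : ClassX4Gord W p) (he : semistabilityIndex W p = 2) (hsurj : Surj W p)
    {W₁ : WeierstrassCurve ℚ} [W₁.IsElliptic] [W₁.IsGloballyMinimal]
    {v : HeightOneSpectrum (𝓞 ℚ)} (hv : ((p : ℕ) : 𝓞 ℚ) ∈ v.asIdeal)
    {L : LocalDatum ℚ (W.geomPrimaryTorsion p) v} {L₁ : LocalDatum ℚ (W₁.geomPrimaryTorsion p) v}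
    (hL : IsRamifiedOrdinaryLine W p L) (hL₁ : IsRamifiedOrdinaryLine W₁ p L₁)
    (hiso : ∃ e : geomTorsion W (p : ℤ) ≃+ geomTorsion W₁ (p : ℤ),
      (∀ (σ : absoluteGaloisGroup ℚ) (P : geomTorsion W (p : ℤ)), e (σ • P) = σ • e P) ∧
      (∀ P : geomTorsion W (p : ℤ),
        AddSubgroup.inclusion (geomTorsion_le_geomPrimaryTorsion W p) P ∈ L.plus ↔
          AddSubgroup.inclusion (geomTorsion_le_geomPrimaryTorsion W₁ p) (e P) ∈ L₁.plus))
    (S₀ : Finset (HeightOneSpectrum (𝓞 ℚ))) (hS₀ : ∀ w ∈ S₀, ((p : ℕ) : 𝓞 ℚ) ∉ w.asIdeal)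
    (hS : ∀ w : HeightOneSpectrum (𝓞 ℚ), w ∉ S₀ → ((p : ℕ) : 𝓞 ℚ) ∉ w.asIdeal →
      W.HasGoodReductionAt w)
    (hS₁ : ∀ w : HeightOneSpectrum (𝓞 ℚ), w ∉ S₀ → ((p : ℕ) : 𝓞 ℚ) ∉ w.asIdeal →
      W₁.HasGoodReductionAt w)
    {r₁ b : ℕ} (hb : (b : ℤ) = r₁ + ∑ w ∈ S₀, ((delta W₁ p w : ℤ) - (delta W p w : ℤ)))
    (hcert : BranchUnitCoeffAt W p b)
    (V : WeierstrassCurve ℚ) [V.IsElliptic] [V.IsGloballyMinimal] (C : VariableChange ℚ)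
    (hC : C • V.quadraticTwist ((-1 : ℚ) ^ (p / 2) * p) = W) (hV : GoodOrd V p)
    {κ : ZpExtension ℚ p} {γ : Field.absoluteGaloisGroup ℚ} {N : ℕ} [NeZero N]
    {f : CuspForm (Gamma0 N) 2}
    (hκ : κ.IsCyclotomic) (hγ : κ.IsTopGenerator γ) (hcv : IsCyclotomicVariable p γ)
    (hf : IsNewformOf V f) (D : W.SelmerDualData κ γ) (D₁ : W₁.SelmerDualData κ γ)
    (hX₁ : D₁.IsTorsion) (hr₁ : r₁ ≤ lambdaInvariant p D₁.X) (ϖ : ℚ)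
    (hϖ : if Even (p / 2) then (ϖ : ℝ) * V.realPeriodRat = plusPeriod f
      else (ϖ : ℝ) * V.imaginaryPeriodRat = minusPeriod f) :
    (D.IsTorsion ∧ ∃ (g : IwasawaAlgebra p) (u : ℤ_[p]ˣ), D.charIdeal = Ideal.span {g} ∧
      iwasawaToPowerSeries p g =
        PowerSeries.C (((u : ℤ_[p]) : ℚ_[p]) * (ϖ : ℚ_[p])) *
          (if Even (p / 2) then padicLFunctionBranch f ((unitRoot V p : ℤ_[p]) : ℚ_[p]) (p / 2)
            else padicLFunctionMinusBranch f ((unitRoot V p : ℤ_[p]) : ℚ_[p]) (p / 2)) ∧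
      D.mu = 0 ∧ lambdaInvariant p D.X = b) ∧ D₁.mu = 0 ∧ lambdaInvariant p D₁.X = r₁ := by
  haveI : Module.Finite (IwasawaAlgebra p) D.X :=
    SelmerDualData.module_finite_of_isCyclotomic (W := W) (κ := κ) hκ D hγ
  haveI : Module.Finite (IwasawaAlgebra p) D₁.X :=
    SelmerDualData.module_finite_of_isCyclotomic (W := W₁) (κ := κ) hκ D₁ hγ
  have hp2 : p ≠ 2 := hX.addv.1
  -- `ρ̄_{E,p}` onto ⟹ `E[p]` irreducible (Serre 1972 §4)
  have hirr : W.HasIrreducibleModPGaloisRep p :=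
    hasIrreducibleModPGaloisRep_of_hasSurjectiveModNGaloisRep W p hsurj
  -- the line-respecting isomorphism is in particular a `TorsionIso`
  have hisoT : TorsionIso W W₁ p := by
    obtain ⟨e, he, -⟩ := hiso
    exact ⟨e, he⟩
  -- EPW Thm. 3.3.3 (2): the λ-shift schema with the explicit shift
  have hG : CongruentLambdaShift W W₁ p (∑ w ∈ S₀, ((delta W₁ p w : ℤ) - (delta W p w : ℤ))) :=
    congruentLambdaShift_of_epw W W₁ p S₀ hEPW hp2 hv hL hL₁ hirr hiso hS₀ hS hS₁
  -- `μ(X(E)) = 0` at the source from Kato half + the unit coefficient (§1) …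
  obtain ⟨hXt, hmu⟩ := hX.isTorsion_and_mu_zero_of_katoHalf_of_coeffCert hK he hsurj hcert V C hC hV
    hκ hγ hcv hf D ϖ hϖ
  -- … transferred to the partner by EPW Thm. 3.3.2
  have hmu₁ : D₁.mu = 0 :=
    mu_eq_zero_of_epw W W₁ p S₀ hEPW hp2 hv hL hL₁ hirr hiso hS₀ hS hS₁ hκ hγ hcv D D₁ hXt hX₁ hmu
  obtain ⟨h, hlam₁⟩ := hX.mainConjecture_of_katoHalf_of_coeffCert_of_congruentPartner hK he hsurj hisoT
    hG hb hcert V C hC hV hκ hγ hcv hf D D₁ hX₁ hmu₁ hr₁ ϖ hϖ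
  exact ⟨h, hmu₁, hlam₁⟩

/-- **K-C′ from the EPW data, partner with no λ-input (`r₁ = 0`).** As
`ClassX4Gord.mainConjecture_of_katoHalf_of_coeffCert_of_epw` with the trivial lower bound at the
partner: the unit coefficient at `E` sits at index `b = Σ_{w ∈ Σ₀} (δ(E₁,w) − δ(E,w))`; conclusion MC
on the branch at `E` with `μ = 0`, `λ(X(E)) = b`, and `μ(X(E₁)) = 0`, `λ(X(E₁)) = 0` at the partner.
READING OF RECORD (referee 1 ACK-1 proviso P1, 2026-08-21): per additive pair EPW 2006 Thm. 3.3.3 is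
applied in its `ω^i`-form (LIT-INPUTS-P3 §11.1, arXiv math/0404484 p0019 L147–166) on the HIDA FAMILY
of `ρ̄_{E♭}` — the `p`-ordinary twist model — at `i = (p−1)/2`, NEVER on `f_E` itself (`a_p(E) = 0`);
`e = B(E,p) − B(E₁,p)`, `b = B(E,p)` the `p`-Tamagawa budget (P2).
[cite: EmertonPollackWeston2006, Thm. 3.3.2, Thm. 3.3.3 (2) (arXiv:math/0404484 p. 19)]
[cite: Kato2004Asterisque, Thm. 17.4 (3) (p. 273)] -/
theorem ClassX4Gord.mainConjecture_of_katoHalf_of_coeffCert_of_epw_of_partnerZero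
    (hK : Wuthrich2014.kato_halfEigenCharIdeal_dvd_cyclotomicPrime_of_surjective)
    (hEPW : muLambdaAlg_transfer_of_torsionIso_potOrd)
    (hX : ClassX4Gord W p) (he : semistabilityIndex W p = 2) (hsurj : Surj W p)
    {W₁ : WeierstrassCurve ℚ} [W₁.IsElliptic] [W₁.IsGloballyMinimal]
    {v : HeightOneSpectrum (𝓞 ℚ)} (hv : ((p : ℕ) : 𝓞 ℚ) ∈ v.asIdeal)
    {L : LocalDatum ℚ (W.geomPrimaryTorsion p) v} {L₁ : LocalDatum ℚ (W₁.geomPrimaryTorsion p) v}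
    (hL : IsRamifiedOrdinaryLine W p L) (hL₁ : IsRamifiedOrdinaryLine W₁ p L₁)
    (hiso : ∃ e : geomTorsion W (p : ℤ) ≃+ geomTorsion W₁ (p : ℤ),
      (∀ (σ : absoluteGaloisGroup ℚ) (P : geomTorsion W (p : ℤ)), e (σ • P) = σ • e P) ∧
      (∀ P : geomTorsion W (p : ℤ),
        AddSubgroup.inclusion (geomTorsion_le_geomPrimaryTorsion W p) P ∈ L.plus ↔
          AddSubgroup.inclusion (geomTorsion_le_geomPrimaryTorsion W₁ p) (e P) ∈ L₁.plus))
    (S₀ : Finset (HeightOneSpectrum (𝓞 ℚ))) (hS₀ : ∀ w ∈ S₀, ((p : ℕ) : 𝓞 ℚ) ∉ w.asIdeal)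
    (hS : ∀ w : HeightOneSpectrum (𝓞 ℚ), w ∉ S₀ → ((p : ℕ) : 𝓞 ℚ) ∉ w.asIdeal →
      W.HasGoodReductionAt w)
    (hS₁ : ∀ w : HeightOneSpectrum (𝓞 ℚ), w ∉ S₀ → ((p : ℕ) : 𝓞 ℚ) ∉ w.asIdeal →
      W₁.HasGoodReductionAt w)
    {b : ℕ} (hb : (b : ℤ) = ∑ w ∈ S₀, ((delta W₁ p w : ℤ) - (delta W p w : ℤ)))
    (hcert : BranchUnitCoeffAt W p b)
    (V : WeierstrassCurve ℚ) [V.IsElliptic] [V.IsGloballyMinimal] (C : VariableChange ℚ)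
    (hC : C • V.quadraticTwist ((-1 : ℚ) ^ (p / 2) * p) = W) (hV : GoodOrd V p)
    {κ : ZpExtension ℚ p} {γ : Field.absoluteGaloisGroup ℚ} {N : ℕ} [NeZero N]
    {f : CuspForm (Gamma0 N) 2}
    (hκ : κ.IsCyclotomic) (hγ : κ.IsTopGenerator γ) (hcv : IsCyclotomicVariable p γ)
    (hf : IsNewformOf V f) (D : W.SelmerDualData κ γ) (D₁ : W₁.SelmerDualData κ γ)
    (hX₁ : D₁.IsTorsion) (ϖ : ℚ)
    (hϖ : if Even (p / 2) then (ϖ : ℝ) * V.realPeriodRat = plusPeriod f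
      else (ϖ : ℝ) * V.imaginaryPeriodRat = minusPeriod f) :
    (D.IsTorsion ∧ ∃ (g : IwasawaAlgebra p) (u : ℤ_[p]ˣ), D.charIdeal = Ideal.span {g} ∧
      iwasawaToPowerSeries p g =
        PowerSeries.C (((u : ℤ_[p]) : ℚ_[p]) * (ϖ : ℚ_[p])) *
          (if Even (p / 2) then padicLFunctionBranch f ((unitRoot V p : ℤ_[p]) : ℚ_[p]) (p / 2)
            else padicLFunctionMinusBranch f ((unitRoot V p : ℤ_[p]) : ℚ_[p]) (p / 2)) ∧
      D.mu = 0 ∧ lambdaInvariant p D.X = b) ∧ D₁.mu = 0 ∧ lambdaInvariant p D₁.X = 0 :=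
  hX.mainConjecture_of_katoHalf_of_coeffCert_of_epw hK hEPW he hsurj hv hL hL₁ hiso S₀ hS₀ hS hS₁
    (r₁ := 0) (by rw [hb]; push_cast; ring) hcert V C hC hV hκ hγ hcv hf D D₁ hX₁ (Nat.zero_le _) ϖ hϖ

end Summit.BirchSwinnertonDyer.Rank1Residual.Additive

end
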